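import Summits.ResolutionOfSingularities.ResolutionOfSingularities.Theorems.PurelyInseparableDim4CrossingLineFixedPoints
import Literature.AlgebraicGeometry.Resolution.PointBlowupKangaroo
import HarnessLib

/-!
# [OURS · res-dim4-pi · F4-C] THE UNION LAW («union = no progress», crit-1's LAW (FIX) / idea-2 g3's LAW X3), every
  field, every `q`: blowing up a coordinate centre `C_U` that is TOO SMALL — every monomial already has
  `U ∖ {j}`-degree `≥ q` — lowers NO exponent in the `x_j`-chart; if that degree is EXACTLY `q` throughout, the
  chart origin returns the state literally (a SPINE self-loop), so every rule playing `U` there loses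

Cell `res-dim4-pi` (D-0157 DOOR 2, wave 2), seat `res-dim4-p-6` g2; the symbolic mechanism behind the located
specimens `CrossingFix.P1/P/Q` (p664477, crit-1 V-A-30 (L)) and p-8 g2's `fixX q` (SPECIMEN FIX-X of idea-2 g3):
there `U` = the CROSSING LINE of two plane components and `U ∖ {j}` = one of the planes, `q`-homogeneous.

* §1 exponent law: `degIn_eq_add_degIn_erase` (`|α|_U = α_j + |α|_{U∖j}`), **`le_chartExponent_of_le`**
  (`q ≤ |α|_{U∖j}` ⇒ `α ≤ chartExponent q U j α` coordinatewise — no exponent drops, the `j`-exponent becomes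
  `α_j + (|α|_{U∖j} − q) ≥ α_j`), **`chartExponent_eq_self_iff`** (`q ≤ |α|_U`:
  `chartExponent q U j α = α ↔ |α|_{U∖j} = q`).
* §2 polynomial law: **`chartTransform_eq_self`** (`∀ α ∈ supp F, |α|_{U∖j} = q` ⇒ the chart transform is `F`
  itself), `pointTransform_origin_eq_self`, `isEquimultiplePoint_origin_of_unionLaw` (the chart origin is
  equimultiple as soon as the origin of `F` is `q`-fold), `step_origin_F_eq_self` (clean `F`: the cleaned
  transform is `F`), **`step_origin_eq_self`** (with the stationary decorations `r_j = ord_U F − q`, `j ∈ exc`: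
  the whole state returns), **`spineEdge_self_of_unionLaw`** — a SPINE SELF-LOOP.
* §3 rule level: **`rule_loses_of_unionLaw`** — over any field, every coordinate rule that answers such a state
  with `U` has the constant branch: `¬ SpineTerminatesUnder q R`, `¬ TerminatesUnder q R`, and (if the state is in
  scope) an infinite in-scope branch of LOCAL replies (`CrossingFix.*_of_selfloop`).  `P₁` is the instance
  `α₁ + α₃ = 3` on both monomials of `x₁x₃²x₄² + x₁³x₂` (`unionLaw_P1`, re-deriving `CrossingFix.spineEdge_P1_x4`
  without `decide`).

Scope (honest): statements about OUR frame (`CentreBlowup.chartExponent/chartTransform/step`, `PIDim4.SpineEdge`);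
the law says when a coordinate centre is a guaranteed non-move, nothing about which centres win.  [OURS · counted 0 ·
elementary; AI kernel work, weaker than expert review.]  NOTHING here is a statement about resolution of
singularities; resolution in dimension `≥ 4` / characteristic `p > 0` is NOT proved by anything in this file.
bears_on: LADDER-RESOLUTION:D157-DOOR2 (res-dim4-pi · F4-C · C-P1 / FIX-X mechanism).  Host item (DR-157-C):
`stmt-ResolutionOfSingularities-16155`, helper.
-/

set_option linter.dupNamespace false -- mandated namespace of this single-conjunct summit

noncomputable section

open MvPolynomial Finset
open scoped BigOperators

namespace Summit.ResolutionOfSingularities.ResolutionOfSingularities.Theorems.PIDim4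

namespace UnionLaw

open Literature.AlgebraicGeometry.Resolution
open Literature.AlgebraicGeometry.Resolution.Hauser2010
open Literature.AlgebraicGeometry.Resolution.CentreBlowup

/-! ## §1 The exponent law -/

section Exponent

variable {σ : Type*} [DecidableEq σ]

/-- `|α|_U = α_j + |α|_{U ∖ {j}}` for `j ∈ U`. OURS (elementary). [folklore] -/
theorem degIn_eq_add_degIn_erase {U : Finset σ} {j : σ} (hj : j ∈ U) (α : σ →₀ ℕ) :
    degIn U α = α j + degIn (U.erase j) α := by
  unfold degIn
  rw [← Finset.add_sum_erase U (fun i => α i) hj]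

/-- **No exponent drops** when `U ∖ {j}` already carries degree `≥ q`: `α ≤ chartExponent q U j α`
coordinatewise (the `j`-exponent becomes `α_j + (|α|_{U∖j} − q)`, the others stay). OURS («union = no
progress», idea-2 g3 LAW X3). [folklore] -/
theorem le_chartExponent_of_le (q : ℕ) {U : Finset σ} {j : σ} (hj : j ∈ U) {α : σ →₀ ℕ}
    (h : q ≤ degIn (U.erase j) α) : α ≤ chartExponent q U j α := by
  intro i
  by_cases hij : i = j
  · subst hij
    rw [chartExponent_apply_self, degIn_eq_add_degIn_erase hj]
    omega
  · rw [chartExponent_apply_of_ne q U hij]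

/-- The `j`-exponent after the chart, in closed form: `α_j + |α|_{U∖j} − q`. OURS. [folklore] -/
theorem chartExponent_apply_self_eq (q : ℕ) {U : Finset σ} {j : σ} (hj : j ∈ U) (α : σ →₀ ℕ) :
    chartExponent q U j α j = α j + degIn (U.erase j) α - q := by
  rw [chartExponent_apply_self, degIn_eq_add_degIn_erase hj]

/-- **Fixed exponents**: for `q ≤ |α|_U`, `chartExponent q U j α = α` iff `|α|_{U ∖ {j}} = q`. OURS (crit-1's
LAW (FIX): `α'_j = |α|_U − q = α_j`). [folklore] -/
theorem chartExponent_eq_self_iff (q : ℕ) {U : Finset σ} {j : σ} (hj : j ∈ U) {α : σ →₀ ℕ}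
    (hq : q ≤ degIn U α) : chartExponent q U j α = α ↔ degIn (U.erase j) α = q := by
  rw [degIn_eq_add_degIn_erase hj] at hq
  constructor
  · intro h
    have hjj : chartExponent q U j α j = α j := by rw [h]
    rw [chartExponent_apply_self_eq q hj] at hjj
    omega
  · intro h
    ext i
    by_cases hij : i = j
    · subst hij
      rw [chartExponent_apply_self_eq q hj, h]
      omega
    · rw [chartExponent_apply_of_ne q U hij]

end Exponent

/-! ## §2 The polynomial law: the chart transform, the point transform and the step return the state -/

section Polynomial

variable {σ : Type*} [DecidableEq σ] {K : Type*} [Field K]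

/-- **The chart transform is `F` itself** when every monomial of `F` has `U ∖ {j}`-degree exactly `q`
(`j ∈ U`). OURS. [folklore] -/
theorem chartTransform_eq_self (q : ℕ) {U : Finset σ} {j : σ} (hj : j ∈ U) {F : MvPolynomial σ K}
    (h : ∀ α ∈ F.support, degIn (U.erase j) α = q) : chartTransform q U j F = F := by
  unfold chartTransform
  conv_rhs => rw [F.as_sum]
  refine Finset.sum_congr rfl (fun α hα => ?_)
  have hq : q ≤ degIn U α := by
    rw [degIn_eq_add_degIn_erase hj, h α hα]
    omega
  rw [(chartExponent_eq_self_iff q hj hq).mpr (h α hα)]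

end Polynomial

section StateLaw

variable {K : Type} [Field K] [DecidableEq K]

omit [DecidableEq K] in
/-- At the chart origin the point transform is the chart transform; under the union law it is `F`. OURS.
[folklore] -/
theorem pointTransform_origin_eq_self (q : ℕ) {U : Finset (Fin 4)} {j : Fin 4} (hj : j ∈ U) (s : State K)
    (h : ∀ α ∈ s.F.support, degIn (U.erase j) α = q) :
    pointTransform q U j (0 : Fin 4 → K) s = s.F := by
  unfold pointTransform
  rw [PointBlowup.translate_zero, chartTransform_eq_self q hj h]

/-- **The chart origin is equimultiple** under the union law as soon as the origin of `F` is `q`-fold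
(`q ≤ ord_univ F`: no monomial of degree `< q`). OURS. [folklore] -/
theorem isEquimultiplePoint_origin_of_unionLaw (q : ℕ) {U : Finset (Fin 4)} {j : Fin 4} (hj : j ∈ U)
    (s : State K) (h : ∀ α ∈ s.F.support, degIn (U.erase j) α = q)
    (hq0 : (q : ℕ∞) ≤ ordAlong Finset.univ s.F) :
    IsEquimultiplePoint q U j (0 : Fin 4 → K) s := by
  intro d hd0 hdeg
  rw [pointTransform_origin_eq_self q hj s h]
  by_contra hne
  have hmem : d ∈ s.F.support := MvPolynomial.mem_support_iff.mpr hne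
  have := (le_ordAlong_iff.mp hq0) d hmem
  rw [degIn_univ] at this
  exact absurd (by exact_mod_cast this : q ≤ d.degree) (not_le.mpr hdeg)

/-- **The cleaned transform at the chart origin is `F`** (clean `F`). OURS. [folklore] -/
theorem step_origin_F_eq_self (q : ℕ) {U : Finset (Fin 4)} {j : Fin 4} (hj : j ∈ U) (s : State K)
    (h : ∀ α ∈ s.F.support, degIn (U.erase j) α = q) (hclean : deletePthPowers q s.F = s.F) :
    (CentreBlowup.step q U j (0 : Fin 4 → K) s).F = s.F := by
  change deletePthPowers q (pointTransform q U j (0 : Fin 4 → K) s) = s.F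
  rw [pointTransform_origin_eq_self q hj s h, hclean]

/-- Under the union law `ord_U F = q + ord_{(x_j)} F`… we only need: `(ord_U F).toNat − q` is the least
`j`-exponent; with the STATIONARY decoration `r_j = (ord_U F).toNat − q` and `j ∈ exc` the whole state returns:
**`step q U j 0 s = s`**. OURS. [folklore] -/
theorem step_origin_eq_self (q : ℕ) {U : Finset (Fin 4)} {j : Fin 4} (hj : j ∈ U) (s : State K)
    (h : ∀ α ∈ s.F.support, degIn (U.erase j) α = q) (hclean : deletePthPowers q s.F = s.F)
    (hr : s.r j = (ordAlong U s.F).toNat - q) (hexc : j ∈ s.exc) :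
    CentreBlowup.step q U j (0 : Fin 4 → K) s = s := by
  have hF := step_origin_F_eq_self q hj s h hclean
  cases s with
  | mk F r exc =>
    simp only [CentreBlowup.step, CState.mk.injEq]
    refine ⟨hF, ?_, ?_⟩
    · -- multiplicities: every old component is kept (`b = 0`), the new one gets `ord_U F − q = r_j`
      unfold newMult
      ext i
      rw [Finsupp.update_apply]
      by_cases hij : i = j
      · subst hij
        rw [if_pos rfl]
        exact hr.symm
      · rw [if_neg hij, Finsupp.filter_apply, if_pos (show (0 : Fin 4 → K) i = 0 from rfl)]
    · -- components: `exc ∪ {j} = exc`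
      unfold newExc
      rw [Finset.filter_true_of_mem (fun i _ => (show (0 : Fin 4 → K) i = 0 from rfl))]
      exact Finset.insert_eq_of_mem hexc

/-- **SPINE SELF-LOOP under the union law**: `U ∋ j`, every monomial of the clean `F ≠ 0` has `U ∖ {j}`-degree
exactly `q`, the origin is `q`-fold, decorations stationary ⇒ `SpineEdge q U s s`. OURS (the mechanism of
`CrossingFix.spineEdge_P1_x4/_x3/_P/_Q` and of p-8 g2's FIX-X, every field, every `q`). [folklore] -/
theorem spineEdge_self_of_unionLaw (q : ℕ) {U : Finset (Fin 4)} {j : Fin 4} (hj : j ∈ U) (s : State K)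
    (h : ∀ α ∈ s.F.support, degIn (U.erase j) α = q) (hclean : deletePthPowers q s.F = s.F)
    (hF : s.F ≠ 0) (hq0 : (q : ℕ∞) ≤ ordAlong Finset.univ s.F)
    (hr : s.r j = (ordAlong U s.F).toNat - q) (hexc : j ∈ s.exc) : SpineEdge q U s s := by
  refine ⟨j, hj, isEquimultiplePoint_origin_of_unionLaw q hj s h hq0, ?_,
    (step_origin_eq_self q hj s h hclean hr hexc).symm⟩
  rw [step_origin_F_eq_self q hj s h hclean]
  exact hF

omit [DecidableEq K] in
/-- The centre `U` is permissible under the union law: every monomial has `|α|_U ≥ |α|_{U∖j} = q`, and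
`U ∋ j` is non-empty. OURS. [folklore] -/
theorem isPermissibleCentre_of_unionLaw (q : ℕ) {U : Finset (Fin 4)} {j : Fin 4} (hj : j ∈ U)
    (F : MvPolynomial (Fin 4) K) (h : ∀ α ∈ F.support, degIn (U.erase j) α = q) :
    IsPermissibleCentre q U F := by
  refine ⟨⟨j, hj⟩, le_ordAlong_iff.mpr fun α hα => ?_⟩
  have : q ≤ degIn U α := by
    rw [degIn_eq_add_degIn_erase hj, h α hα]
    omega
  exact_mod_cast this

end StateLaw

/-! ## §3 Rule level: every rule playing `U` at such a state loses — spine, local, global -/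

section Rule

variable {K : Type} [Field K] [DecidableEq K]

/-- **THE UNION LAW, rule form** (every field, every `q`): at a state `s` satisfying the union law for the centre
`U ∋ j` (clean `F ≠ 0`, `q`-fold origin, stationary decorations), every coordinate rule `R` with `R s = U` has
the constant branch — no termination in the SPINE game, hence none in the local or global game. OURS. [folklore] -/
theorem rule_loses_of_unionLaw (q : ℕ) {U : Finset (Fin 4)} {j : Fin 4} (hj : j ∈ U) (s : State K)
    (h : ∀ α ∈ s.F.support, degIn (U.erase j) α = q) (hclean : deletePthPowers q s.F = s.F)
    (hF : s.F ≠ 0) (hq0 : (q : ℕ∞) ≤ ordAlong Finset.univ s.F)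
    (hr : s.r j = (ordAlong U s.F).toNat - q) (hexc : j ∈ s.exc) (R : CentreRule K) (hR : R s = U) :
    ¬ SpineTerminatesUnder q R ∧ ¬ TerminatesUnder q R := by
  have hperm : IsPermissibleCentre q (R s) s.F := hR ▸ isPermissibleCentre_of_unionLaw q hj s.F h
  have hloop : SpineEdge q (R s) s s := hR ▸ spineEdge_self_of_unionLaw q hj s h hclean hF hq0 hr hexc
  exact ⟨CrossingFix.not_spineTerminatesUnder_of_selfloop hperm hloop,
    CrossingFix.not_terminatesUnder_of_selfloop hperm hloop⟩

/-- … and, if the state is in coordinate scope, an infinite in-scope branch of LOCAL replies (`b = 0`).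
OURS. [folklore] -/
theorem exists_local_inScope_branch_of_unionLaw (q : ℕ) {U : Finset (Fin 4)} {j : Fin 4} (hj : j ∈ U)
    (s : State K) (h : ∀ α ∈ s.F.support, degIn (U.erase j) α = q) (hclean : deletePthPowers q s.F = s.F)
    (hF : s.F ≠ 0) (hq0 : (q : ℕ∞) ≤ ordAlong Finset.univ s.F)
    (hr : s.r j = (ordAlong U s.F).toNat - q) (hexc : j ∈ s.exc) (hscope : InCoordinateScope q s.F)
    (R : CentreRule K) (hR : R s = U) :
    ∃ c : ℕ → State K, ∀ k, InCoordinateScope q (c k).F ∧ IsPermissibleCentre q (R (c k)) (c k).F ∧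
      LoopCLocal.RSucc q LoopCLocal.localB (c k) (R (c k)) (c (k + 1)) := by
  have hperm : IsPermissibleCentre q (R s) s.F := hR ▸ isPermissibleCentre_of_unionLaw q hj s.F h
  obtain ⟨j', hj', heq, hne, hs⟩ := hR ▸ spineEdge_self_of_unionLaw q hj s h hclean hF hq0 hr hexc
  exact CrossingFix.exists_local_inScope_branch_of_selfloop hperm hscope
    ⟨j', 0, hj', rfl, by simp [LoopCLocal.localB], heq, hne, hs⟩

end Rule

/-! ## §4 The instance `P₁` (crit-1): `α₁ + α₃ = 3` on both monomials of `x₁x₃²x₄² + x₁³x₂` -/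

section Instance

open StepKit CrossingFix

/-- `P₁` satisfies the union law for `U = V(x₁,x₃,x₄)`, chart `x₄`: both monomials have `(U∖{x₄})`-degree
`α₁ + α₃ = 3`. [OURS · ‖ K] -/
theorem unionLaw_P1 : ∀ α ∈ P1.toState.F.support, degIn (U1.erase 3) α = 3 := by
  intro α hα
  rw [SData.toState_F, mem_support_evalT_iff] at hα
  have hlive : (⇑α) ∈ live P1.L := hα
  have hall : ∀ e ∈ live P1.L, e = ![1, 0, 2, 2] ∨ e = ![3, 1, 0, 0] := by decide +kernel
  have hcases := hall _ hlive
  have hsum : degIn (U1.erase 3) α = α 0 + α 2 := by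
    rw [show U1.erase 3 = ({0, 2} : Finset (Fin 4)) by decide]
    exact CentreBlowup.degIn_pair (by decide) α
  rw [hsum]
  rcases hcases with h | h
  · have h0 : α 0 = 1 := congrFun h 0
    have h2 : α 2 = 2 := congrFun h 2
    omega
  · have h0 : α 0 = 3 := congrFun h 0
    have h2 : α 2 = 0 := congrFun h 2
    omega

/-- **`P₁`'s spine self-loop re-derived from the union law** (no `decide` on the step): the symbolic mechanism
agrees with the kernel certificate `CrossingFix.spineEdge_P1_x4`. [OURS · ‖ K] -/
theorem spineEdge_P1_of_unionLaw : SpineEdge 3 U1 P1.toState P1.toState :=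
  spineEdge_self_of_unionLaw 3 (by decide) P1.toState unionLaw_P1
    (by rw [SData.toState_F, deletePthPowers_evalT]; exact (evalT_eq_iff_equivB _ _).mpr (by decide +kernel))
    (by rw [SData.toState_F, Ne, evalT_eq_zero_iff]; decide +kernel)
    (((isPermissibleCentre_iff 3 Finset.univ P1.L).mpr (by decide +kernel)).2)
    (by rw [SData.toState_r, SData.toState_F, toNat_ordAlong_evalT, expo_apply]; decide +kernel)
    (by decide)

end Instance

end UnionLaw

end Summit.ResolutionOfSingularities.ResolutionOfSingularities.Theorems.PIDim4

end
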